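import Mathlib.NumberTheory.LSeries.AbstractFuncEq
import Mathlib.NumberTheory.LSeries.MellinEqDirichlet
import Literature.NumberTheory.LFunctions.GaussianHeckeThetaFE
import Literature.NumberTheory.LFunctions.GaussianPrimesInSectors
import HarnessLib

/-!
# The Hecke `L`-functions `L(s, λ^m)` of `ℚ(i)`: analytic continuation via the theta series

Topic `Literature/NumberTheory/LFunctions`, sequel to `GaussianHeckeThetaFE.lean` (theta series
`θ_k(t) = ∑_{z ∈ ℤ[i]} z^k e^{-π t N(z)}` and `θ_k(1/t) = i^k t^{k+1} θ_k(t)`).  Second analytic brick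
of the proof of Hecke's theorem on Gaussian primes in sectors
(`Literature.NumberTheory.LFunctions.GaussianInt.hecke_gaussianPrimes_inSectors`).  Everything is
PROVED; no named facts.

For `m : ℕ` let `λ^m(z) = (z/|z|)^{4m}` (`Literature.NumberTheory.LFunctions.GaussianInt.angularChar`)
and consider the Dirichlet series over ALL nonzero Gaussian integers (four associates per ideal)

  `D_m(s) = ∑_{z ∈ ℤ[i], z ≠ 0} λ^m(z) N(z)^{-s} = ∑_z z^{4m} N(z)^{-(s+2m)}`   (`Re s > 1`),

i.e. `D_m = 4 L(s, λ^m)` with Hecke's `L`-function of the Grössencharakter `λ^m` of `ℚ(i)`.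

* `thetaPair k` — Mathlib's `WeakFEPair` packaging of `θ_k`: `f = g = θ_k`, weight `k + 1`, root
  number `i^k`, constant terms `f₀ = g₀ = [k = 0]` (exponential decay `θ_k(t) - [k=0] = O(e^{-πt})`,
  `isBigO_theta_sub`, and continuity on `(0, ∞)`, `continuousOn_theta`);
* `heckeL m s = π^{s+2m} Γ(s+2m)⁻¹ Λ_{4m}(s + 2m)` with `Λ_k = (thetaPair k).Λ` — the continuation of
  `D_m`: **entire for `m ≥ 1`** (`differentiable_heckeL`), holomorphic off `s = 0, 1` for `m = 0`
  (`differentiableAt_heckeL_zero`), and **equal to the Dirichlet series for `Re s > 1`**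
  (`hasSum_heckeL`);
* for `m = 0` (four times the Dedekind zeta function of `ℚ(i)`): `heckeH s = (s - 1) D_0(s)` written
  through the entire `Λ₀`, holomorphic at every `s ≠ 0` with `heckeH 1 = π` (`heckeH_one`,
  `heckeH_eq`), i.e. `D_0` has a simple pole at `s = 1` with residue `π = 4 · (π/4)`.

## References

* E. Hecke, *Eine neue Art von Zetafunktionen und ihre Beziehungen zur Verteilung der
  Primzahlen. II*, Math. Z. 6 (1920), 11–51, §9. [HeckeMathZ1920]
-/

noncomputable section

open Complex Real Filter Topology Asymptotics Set MeasureTheory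

namespace Literature.NumberTheory.LFunctions

namespace GaussianHecke

local notation "ℤ[i]" => GaussianInt

/-! ### Norms of the theta summands; continuity of `θ_k` -/

/-- `‖x^k e^{-π t N(x)}‖ = |x|^k e^{-π t N(x)}`. [folklore] -/
theorem norm_thetaTerm (k : ℕ) (t : ℝ) (x : ℤ[i]) :
    ‖thetaTerm k t x‖ = ‖(x : ℂ)‖ ^ k * rexp (-π * t * (x.norm : ℝ)) := by
  rw [thetaTerm, norm_mul, norm_ofReal_exp, norm_pow]

/-- The term at `x = 0` is `[k = 0]`. [folklore] -/
theorem thetaTerm_zero (k : ℕ) (t : ℝ) : thetaTerm k t 0 = if k = 0 then 1 else 0 := by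
  rw [thetaTerm, map_zero, Zsqrtd.norm_zero, Int.cast_zero, mul_zero, Real.exp_zero, ofReal_one,
    mul_one]
  rcases Nat.eq_zero_or_pos k with rfl | hk
  · simp
  · rw [zero_pow hk.ne', if_neg hk.ne']

/-- Monotonicity in `t`: `‖x^k e^{-π t N(x)}‖ ≤ ‖x^k e^{-π a N(x)}‖` for `a ≤ t`. [folklore] -/
theorem norm_thetaTerm_mono (k : ℕ) {a t : ℝ} (hat : a ≤ t) (x : ℤ[i]) :
    ‖thetaTerm k t x‖ ≤ ‖thetaTerm k a x‖ := by
  rw [norm_thetaTerm, norm_thetaTerm]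
  have hN : (0 : ℝ) ≤ (x.norm : ℝ) := by exact_mod_cast GaussianInt.norm_nonneg x
  refine mul_le_mul_of_nonneg_left (Real.exp_le_exp.mpr ?_) (pow_nonneg (norm_nonneg _) _)
  nlinarith [mul_nonneg (mul_nonneg pi_pos.le (sub_nonneg.mpr hat)) hN]

/-- `θ_k` is continuous on `(0, ∞)` (locally uniform convergence). [folklore] -/
theorem continuousOn_theta (k : ℕ) : ContinuousOn (theta k) (Ioi 0) := by
  refine continuousOn_of_forall_continuousAt fun t₀ ht₀ ↦ ?_
  have ht₀' : (0 : ℝ) < t₀ := ht₀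
  have ha : 0 < t₀ / 2 := half_pos ht₀'
  have hcont : ContinuousOn (theta k) (Ici (t₀ / 2)) := by
    refine continuousOn_tsum (f := fun x t ↦ thetaTerm k t x) (fun x ↦ ?_)
      (summable_norm_thetaTerm k ha) (fun x t ht ↦ norm_thetaTerm_mono k ht x)
    exact Continuous.continuousOn (by unfold thetaTerm; fun_prop)
  exact hcont.continuousAt (Ici_mem_nhds (by linarith))

/-! ### Exponential decay of `θ_k - [k = 0]` at `∞` -/

/-- For `t ≥ 1` and `x ≠ 0`: `‖x^k e^{-π t N(x)}‖ ≤ e^{-π(t-1)} ‖x^k e^{-π N(x)}‖` (`N(x) ≥ 1`).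
[folklore] -/
theorem norm_thetaTerm_le_exp_mul (k : ℕ) {t : ℝ} (ht : 1 ≤ t) {x : ℤ[i]} (hx : x ≠ 0) :
    ‖thetaTerm k t x‖ ≤ rexp (-π * (t - 1)) * ‖thetaTerm k 1 x‖ := by
  rw [norm_thetaTerm, norm_thetaTerm, mul_left_comm, ← Real.exp_add]
  have hN : (1 : ℝ) ≤ (x.norm : ℝ) := by
    have h1 : (1 : ℤ) ≤ x.norm := by have := GaussianInt.norm_pos.mpr hx; omega
    exact_mod_cast h1
  refine mul_le_mul_of_nonneg_left (Real.exp_le_exp.mpr ?_) (pow_nonneg (norm_nonneg _) _)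
  nlinarith [mul_nonneg (mul_nonneg pi_pos.le (sub_nonneg.mpr ht)) (sub_nonneg.mpr hN)]

/-- `‖θ_k(t) - [k = 0]‖ ≤ e^{-π(t-1)} ∑_x ‖x^k e^{-π N(x)}‖` for `t ≥ 1`. [folklore] -/
theorem norm_theta_sub_le (k : ℕ) {t : ℝ} (ht : 1 ≤ t) :
    ‖theta k t - (if k = 0 then 1 else 0)‖ ≤
      rexp (-π * (t - 1)) * ∑' x : ℤ[i], ‖thetaTerm k 1 x‖ := by
  have ht0 : 0 < t := by linarith
  have h1 : HasSum (fun x : ℤ[i] ↦ thetaTerm k t x - if x = 0 then thetaTerm k t 0 else 0)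
      (theta k t - thetaTerm k t 0) := (hasSum_theta k ht0).sub (hasSum_ite_eq 0 _)
  rw [← thetaTerm_zero k t, ← h1.tsum_eq]
  have hb := ((summable_norm_thetaTerm k one_pos).mul_left (rexp (-π * (t - 1)))).hasSum
  rw [← tsum_mul_left]
  refine tsum_of_norm_bounded hb fun x ↦ ?_
  by_cases hx : x = 0
  · subst hx
    rw [if_pos rfl, sub_self, norm_zero]
    positivity
  · rw [if_neg hx, sub_zero]
    exact norm_thetaTerm_le_exp_mul k ht hx

/-- **`θ_k(t) - [k = 0] = O(t^r)` at `∞` for every real `r`** (indeed `O(e^{-πt})`). [folklore] -/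
theorem isBigO_theta_sub (k : ℕ) (r : ℝ) :
    (fun t ↦ theta k t - (if k = 0 then 1 else 0)) =O[atTop] fun t ↦ t ^ r := by
  have h1 : (fun t ↦ theta k t - (if k = 0 then 1 else 0)) =O[atTop]
      fun t ↦ rexp (-π * t) := by
    refine IsBigO.of_bound (rexp π * ∑' x : ℤ[i], ‖thetaTerm k 1 x‖) ?_
    filter_upwards [eventually_ge_atTop 1] with t ht
    refine (norm_theta_sub_le k ht).trans (le_of_eq ?_)
    rw [Real.norm_of_nonneg (Real.exp_pos _).le, show -π * (t - 1) = -π * t + π by ring,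
      Real.exp_add]
    ring
  exact h1.trans (isLittleO_exp_neg_mul_rpow_atTop pi_pos r).isBigO

/-! ### The FE-pair of `θ_k` and the continued `L`-functions -/

/-- `θ_k` as a weak FE-pair (Mathlib `WeakFEPair`): `f = g = θ_k`, weight `k + 1`, root number
`i^k`, constant terms `[k = 0]`; the functional equation is `theta_one_div`. [folklore] -/
def thetaPair (k : ℕ) : WeakFEPair ℂ where
  f := theta k
  g := theta k
  k := k + 1
  ε := I ^ k
  f₀ := if k = 0 then 1 else 0
  g₀ := if k = 0 then 1 else 0
  hf_int := (continuousOn_theta k).locallyIntegrableOn measurableSet_Ioi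
  hg_int := (continuousOn_theta k).locallyIntegrableOn measurableSet_Ioi
  hk := by positivity
  hε := pow_ne_zero _ I_ne_zero
  h_feq := fun x hx ↦ by
    rw [theta_one_div k hx, smul_eq_mul]
    congr 1
    rw [show ((k : ℝ) + 1) = ((k + 1 : ℕ) : ℝ) by push_cast; ring, Real.rpow_natCast]
    push_cast
    ring
  hf_top := isBigO_theta_sub k
  hg_top := isBigO_theta_sub k

/-- For `k ≥ 1` the FE-pair of `θ_k` is strong (no constant terms). [folklore] -/
theorem isStrongFEPair_thetaPair {k : ℕ} (hk : k ≠ 0) : IsStrongFEPair (thetaPair k) where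
  hf₀ := if_neg hk
  hg₀ := if_neg hk

/-- **The continued Dirichlet series `D_m(s) = ∑_{z ≠ 0} λ^m(z) N(z)^{-s}`** (`= 4 L(s, λ^m)`):
`heckeL m s = π^{s+2m} Γ(s+2m)⁻¹ Λ_{4m}(s + 2m)`, `Λ_k` the completed Mellin transform of the
FE-pair of `θ_k` (Hecke 1920, §9). [cite: HeckeMathZ1920, §9] -/
def heckeL (m : ℕ) (s : ℂ) : ℂ :=
  (π : ℂ) ^ (s + 2 * m) * (Complex.Gamma (s + 2 * m))⁻¹ * (thetaPair (4 * m)).Λ (s + 2 * m)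

/-- **`D_m` is entire for `m ≥ 1`** (Hecke). [cite: HeckeMathZ1920, §9] -/
theorem differentiable_heckeL {m : ℕ} (hm : m ≠ 0) : Differentiable ℂ (heckeL m) := by
  have hπ : (π : ℂ) ≠ 0 := ofReal_ne_zero.mpr Real.pi_ne_zero
  have h4 : 4 * m ≠ 0 := by omega
  have hΛ : Differentiable ℂ (thetaPair (4 * m)).Λ :=
    (isStrongFEPair_thetaPair h4).differentiable_Λ
  intro s
  have hsh : DifferentiableAt ℂ (fun s : ℂ ↦ s + 2 * m) s := differentiableAt_id.add_const _
  unfold heckeL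
  refine ((hsh.const_cpow (Or.inl hπ)).mul ?_).mul (hΛ.differentiableAt.comp s hsh)
  exact (Complex.differentiable_one_div_Gamma.differentiableAt).comp s hsh

/-- For `m = 0`, `D_0` is holomorphic at every `s ≠ 0, 1`. [cite: HeckeMathZ1920, §9] -/
theorem differentiableAt_heckeL_zero {s : ℂ} (hs0 : s ≠ 0) (hs1 : s ≠ 1) :
    DifferentiableAt ℂ (heckeL 0) s := by
  have hπ : (π : ℂ) ≠ 0 := ofReal_ne_zero.mpr Real.pi_ne_zero
  have hΛ : DifferentiableAt ℂ (thetaPair 0).Λ s := by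
    refine (thetaPair 0).differentiableAt_Λ (Or.inl hs0) (Or.inl ?_)
    simp only [thetaPair, Nat.cast_zero, zero_add, ne_eq]
    exact_mod_cast hs1
  have heq : heckeL 0 = fun s ↦ (π : ℂ) ^ s * (Complex.Gamma s)⁻¹ * (thetaPair 0).Λ s := by
    funext s; simp [heckeL]
  rw [heq]
  exact ((differentiableAt_id.const_cpow (Or.inl hπ)).mul
    Complex.differentiable_one_div_Gamma.differentiableAt).mul hΛ

/-- `H(s) = π^s Γ(s)⁻¹ ((s - 1) Λ₀(s) - (s - 1)/s + 1)`: the function `(s - 1) D_0(s)` written through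
the entire function `Λ₀` of the FE-pair of `θ_0` (whose `Λ(s) = Λ₀(s) - 1/s - 1/(1 - s)`).
[folklore] -/
def heckeH (s : ℂ) : ℂ :=
  (π : ℂ) ^ s * (Complex.Gamma s)⁻¹ * ((s - 1) * (thetaPair 0).Λ₀ s - (s - 1) / s + 1)

/-- `H` is holomorphic at every `s ≠ 0`. [folklore] -/
theorem differentiableAt_heckeH {s : ℂ} (hs0 : s ≠ 0) : DifferentiableAt ℂ heckeH s := by
  have hπ : (π : ℂ) ≠ 0 := ofReal_ne_zero.mpr Real.pi_ne_zero
  have hΛ₀ := (thetaPair 0).differentiable_Λ₀.differentiableAt (x := s)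
  unfold heckeH
  refine ((differentiableAt_id.const_cpow (Or.inl hπ)).mul
    Complex.differentiable_one_div_Gamma.differentiableAt).mul ?_
  refine (((differentiableAt_id.sub_const 1).mul hΛ₀).sub ?_).add_const 1
  exact (differentiableAt_id.sub_const 1).div differentiableAt_id hs0

/-- `H(1) = π`: the residue of `D_0` at `s = 1` is `π` (`= 4 · π/4`, four times the residue of
`ζ_{ℚ(i)}`). [folklore] -/
theorem heckeH_one : heckeH 1 = π := by
  simp [heckeH, Complex.Gamma_one]

/-- `H(s) = (s - 1) D_0(s)` for `s ≠ 1` (at `s = 0` both sides carry Lean's junk value `1/0 = 0`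
consistently, so no hypothesis `s ≠ 0` is needed). [folklore] -/
theorem heckeH_eq {s : ℂ} (hs1 : s ≠ 1) : heckeH s = (s - 1) * heckeL 0 s := by
  have h1s : (1 : ℂ) - s ≠ 0 := sub_ne_zero.mpr (Ne.symm hs1)
  have hk : (((thetaPair 0).k : ℝ) : ℂ) = 1 := by simp [thetaPair]
  have hf : (thetaPair 0).f₀ = 1 := by simp [thetaPair]
  have hg : (thetaPair 0).g₀ = 1 := by simp [thetaPair]
  have hε : (thetaPair 0).ε = 1 := by simp [thetaPair]
  have hΛ : (thetaPair 0).Λ s = (thetaPair 0).Λ₀ s - 1 / s - 1 / (1 - s) := by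
    rw [WeakFEPair.Λ, hk, hf, hg, hε, smul_eq_mul, smul_eq_mul, mul_one, mul_one]
  have hkey : -(s - 1) / (1 - s) = (1 : ℂ) := by rw [neg_sub, div_self h1s]
  simp only [heckeH, heckeL, Nat.cast_zero, mul_zero, add_zero, hΛ]
  linear_combination (-(π : ℂ) ^ s * (Complex.Gamma s)⁻¹) * hkey

/-! ### The Dirichlet series for `Re s > 1` -/

/-- For `t > 0`: `∑_{x} [N x ≠ 0] x^k e^{-π N(x) t} = θ_k(t) - [k = 0]` (the series of `θ_k` with
the term at `x = 0` removed, in the normalisation of `hasSum_mellin_pi_mul₀`). [folklore] -/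
theorem hasSum_thetaTerm_sub (k : ℕ) {t : ℝ} (ht : 0 < t) :
    HasSum (fun x : ℤ[i] ↦ if (x.norm : ℝ) = 0 then 0 else (x : ℂ) ^ k * rexp (-π * (x.norm : ℝ) * t))
      (theta k t - if k = 0 then 1 else 0) := by
  have h1 : HasSum (fun x : ℤ[i] ↦ thetaTerm k t x - if x = 0 then thetaTerm k t 0 else 0)
      (theta k t - thetaTerm k t 0) := (hasSum_theta k ht).sub (hasSum_ite_eq 0 _)
  rw [← thetaTerm_zero k t]
  refine h1.congr_fun fun x ↦ ?_
  have hN : ((x.norm : ℝ) = 0) ↔ x = 0 := by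
    rw [Int.cast_eq_zero, GaussianInt.norm_eq_zero]
  by_cases hx : x = 0
  · subst hx
    simp
  · rw [if_neg (hN.not.mpr hx), if_neg hx, sub_zero, thetaTerm]
    push_cast
    ring_nf

/-- `‖x^k‖ / N(x)^σ = N(x)^{-(σ - k/2)}` is summable over `ℤ[i]` for `σ > k/2 + 1`. [folklore] -/
theorem summable_norm_pow_div_rpow (k : ℕ) {σ : ℝ} (hσ : (k : ℝ) / 2 + 1 < σ) :
    Summable fun x : ℤ[i] ↦ ‖(x : ℂ) ^ k‖ / (x.norm : ℝ) ^ σ := by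
  have hr : 1 < σ - k / 2 := by linarith
  refine (GaussianTheta.summable_norm_rpow_neg hr).congr fun x ↦ ?_
  have hN0 : (0 : ℝ) ≤ ((x.norm : ℤ) : ℝ) := by exact_mod_cast GaussianInt.norm_nonneg x
  rcases hN0.eq_or_lt with hN | hN
  · have hx : x = 0 := by rw [← GaussianInt.norm_eq_zero]; exact_mod_cast hN.symm
    subst hx
    have hσ0 : 0 < σ := by
      have : (0 : ℝ) ≤ (k : ℝ) / 2 := by positivity
      linarith
    rw [map_zero, Zsqrtd.norm_zero, Int.cast_zero, Real.zero_rpow (by linarith : -(σ - (k : ℝ) / 2) ≠ 0),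
      Real.zero_rpow hσ0.ne', div_zero]
  · rw [norm_pow, GaussianTheta.norm_toComplex, ← Real.rpow_natCast, ← Real.rpow_mul hN0,
      ← Real.rpow_sub hN]
    congr 1
    ring

/-- **Mellin transform of `θ_k - [k = 0]`**: for `Re s > k/2 + 1`,
`∫₀^∞ (θ_k(t) - [k=0]) t^{s-1} dt = π^{-s} Γ(s) ∑_{x ≠ 0} x^k N(x)^{-s}`. [folklore] -/
theorem hasSum_mellin_theta_sub (k : ℕ) {s : ℂ} (hs : (k : ℝ) / 2 + 1 < s.re) :
    HasSum (fun x : ℤ[i] ↦ (π : ℂ) ^ (-s) * Complex.Gamma s * (x : ℂ) ^ k /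
        (((x.norm : ℝ)) : ℂ) ^ s)
      (mellin (fun t ↦ theta k t - if k = 0 then 1 else 0) s) := by
  have hs0 : 0 < s.re := by
    have : (0 : ℝ) ≤ (k : ℝ) / 2 := by positivity
    linarith
  exact hasSum_mellin_pi_mul₀ (fun x ↦ by exact_mod_cast GaussianInt.norm_nonneg x) hs0
    (fun t ht ↦ hasSum_thetaTerm_sub k ht) (summable_norm_pow_div_rpow k hs)

/-- `Λ_k(s) = ∫₀^∞ (θ_k(t) - [k=0]) t^{s-1} dt` whenever `Re s > k/2 + 1` (for `k ≥ 1` the pair is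
strong and this holds for all `s`; for `k = 0` it is Mathlib's `WeakFEPair.hasMellin`, `Re s > 1`).
[folklore] -/
theorem thetaPair_Λ_eq_mellin (k : ℕ) {s : ℂ} (hs : (k : ℝ) / 2 + 1 < s.re) :
    (thetaPair k).Λ s = mellin (fun t ↦ theta k t - if k = 0 then 1 else 0) s := by
  rcases Nat.eq_zero_or_pos k with rfl | hk
  · have hk1 : (thetaPair 0).k < s.re := by
      show ((0 : ℕ) : ℝ) + 1 < s.re
      norm_num at hs ⊢
      exact hs
    exact ((thetaPair 0).hasMellin hk1).2.symm
  · have hS := isStrongFEPair_thetaPair hk.ne'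
    simp only [if_neg hk.ne', sub_zero]
    exact (hS.hasMellin s).2.symm

/-- `|x|^{4m} = N(x)^{2m}` in `ℂ`: `(‖x‖ : ℂ)^{4m} = (N x : ℂ)^{2m}`. [folklore] -/
theorem ofReal_norm_pow_four_mul (m : ℕ) (x : ℤ[i]) :
    ((‖(x : ℂ)‖ : ℝ) : ℂ) ^ (4 * m) = (((x.norm : ℝ)) : ℂ) ^ (2 * m) := by
  rw [show 4 * m = 2 * (2 * m) by ring, pow_mul, ← ofReal_pow, Complex.sq_norm,
    ← GaussianInt.intCast_real_norm]

/-- The summand identity `λ^m(x) N(x)^{-s} = x^{4m} N(x)^{-(s+2m)}` for `x ≠ 0`. [folklore] -/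
theorem angularChar_div_cpow {m : ℕ} {x : ℤ[i]} (hx : x ≠ 0) (s : ℂ) :
    GaussianInt.angularChar m x / (((x.norm : ℝ)) : ℂ) ^ s =
      (x : ℂ) ^ (4 * m) / (((x.norm : ℝ)) : ℂ) ^ (s + 2 * m) := by
  have hN : (((x.norm : ℝ)) : ℂ) ≠ 0 := by
    have := GaussianInt.norm_pos.mpr hx
    exact_mod_cast this.ne'
  rw [GaussianInt.angularChar_def, div_pow, ofReal_norm_pow_four_mul, div_div, ← cpow_natCast _ (2 * m),
    ← cpow_add _ _ hN]
  congr 2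
  push_cast
  ring

/-- **`D_m(s) = ∑_{z ≠ 0} λ^m(z) N(z)^{-s}` for `Re s > 1`** (absolutely convergent), where
`λ^m = angularChar m`. [cite: HeckeMathZ1920, §9] -/
theorem hasSum_heckeL (m : ℕ) {s : ℂ} (hs : 1 < s.re) :
    HasSum (fun x : ℤ[i] ↦ if x = 0 then 0 else
      GaussianInt.angularChar m x / (((x.norm : ℝ)) : ℂ) ^ s) (heckeL m s) := by
  have hre : ((4 * m : ℕ) : ℝ) / 2 + 1 < (s + 2 * m).re := by
    rw [add_re]
    simp only [Nat.cast_mul, Nat.cast_ofNat, mul_re, re_ofNat, natCast_re, im_ofNat,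
      natCast_im, mul_zero, sub_zero]
    linarith
  have hs'0 : 0 < (s + 2 * m).re := by
    have : (0 : ℝ) ≤ ((4 * m : ℕ) : ℝ) / 2 := by positivity
    linarith
  have hs'ne : s + 2 * m ≠ 0 := fun h ↦ by rw [h, zero_re] at hs'0; exact lt_irrefl _ hs'0
  have hπ : (π : ℂ) ≠ 0 := ofReal_ne_zero.mpr Real.pi_ne_zero
  have hπs : (π : ℂ) ^ (s + 2 * m) ≠ 0 := by
    rw [Ne, cpow_eq_zero_iff]
    exact fun h ↦ hπ h.1
  have hΓ : Complex.Gamma (s + 2 * m) ≠ 0 := Complex.Gamma_ne_zero_of_re_pos hs'0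
  have h := hasSum_mellin_theta_sub (4 * m) hre
  rw [← thetaPair_Λ_eq_mellin (4 * m) hre] at h
  have h2 := h.mul_left ((π : ℂ) ^ (s + 2 * m) * (Complex.Gamma (s + 2 * m))⁻¹)
  refine h2.congr_fun fun x ↦ ?_
  -- termwise: `π^{s'} Γ(s')⁻¹ · π^{-s'} Γ(s') x^{4m} / N^{s'} = [x ≠ 0] λ^m(x) / N^s`
  have hcancel : (π : ℂ) ^ (s + 2 * m) * (Complex.Gamma (s + 2 * m))⁻¹ *
      ((π : ℂ) ^ (-(s + 2 * m)) * Complex.Gamma (s + 2 * m)) = 1 := by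
    rw [cpow_neg]
    field_simp
  by_cases hx : x = 0
  · subst hx
    simp only [if_true, map_zero, Zsqrtd.norm_zero, Int.cast_zero, Complex.ofReal_zero,
      Complex.zero_cpow hs'ne, div_zero, mul_zero]
  · rw [if_neg hx, angularChar_div_cpow hx s,
      show (π : ℂ) ^ (s + 2 * m) * (Complex.Gamma (s + 2 * m))⁻¹ *
          ((π : ℂ) ^ (-(s + 2 * m)) * Complex.Gamma (s + 2 * m) * (x : ℂ) ^ (4 * m) /
            (((x.norm : ℝ)) : ℂ) ^ (s + 2 * m)) =
        ((π : ℂ) ^ (s + 2 * m) * (Complex.Gamma (s + 2 * m))⁻¹ *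
          ((π : ℂ) ^ (-(s + 2 * m)) * Complex.Gamma (s + 2 * m))) *
          ((x : ℂ) ^ (4 * m) / (((x.norm : ℝ)) : ℂ) ^ (s + 2 * m)) by ring,
      hcancel, one_mul]

end GaussianHecke

end Literature.NumberTheory.LFunctions
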